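import Summits.PneNP.PneNP.Theorems.SymmetryBudgetWindowHamIffNPNotSubsetPPoly
import Literature.Computability.Complexity.ClayProblemConsequences
import Literature.Computability.Complexity.KarpLipton
import Literature.Barriers.PneNP.FeasibleInterpolationRSAPairNP
import Literature.Barriers.PneNP.NaturalProofsProofs

/-!
# Crux `WindowHam` (stmt-PneNP-2143) in the tree's web of registered conjectures and barriers

`WindowHam` is calibrated at `NP ⊄ P/poly` (`windowHam_iff_npNotSubsetPPoly`, p127107; by-name crux links
to `Circuit.CircuitThesis` / `RigidBenchmark`, p127635). This file records, with kernel-checked arrows and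
WITHOUT any named-fact hypothesis (Karp–Lipton, Cook–Levin's `SAT ∈ NP`, the natural proofs barrier and
the RSA-pair implications are all PROVED in the tree), where that node sits among the hypotheses and
barriers the tree already registers — the data a planner needs to re-type the crux as a conjecture node:

* `windowHam_of_PH_ne_SigmaP_two`, `PH_eq_SigmaP_two_of_not_windowHam`, `windowHam_or_PH_eq_SigmaP_two` —
  Karp–Lipton: the crux holds unless the polynomial hierarchy collapses to `Σ₂ᵖ` (the exact known cost of `¬ WindowHam`);
* `windowHam_iff_SAT_not_mem_PPoly` — Cook–Levin form: the crux is `SAT ∉ P/poly`;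
* `windowHam_of_rsaPairInseparable`, `windowHam_of_rsaParitySecurePPoly` — the registered cryptographic
  hypotheses of Krajíček–Pudlák (conjecture leaves of `Literature.Barriers.PneNP.FeasibleInterpolation`) imply the crux;
* `windowHam_of_naturalProof`, `windowHam_naturalProofs_barrier` — the BARRIERS entry made formal: a natural
  property met infinitely often by the slices of some `NP` language would prove the crux, and under the SPRNG
  hypothesis `HardPRGExist` no such pair exists (Razborov–Rudich Thm. 4.1, proved in the tree);
* `windowHam_conjecture_web` — the chain in one statement.

Nothing here is progress on the crux itself (it is `NP ⊄ P/poly`, open); every arrow is one line over landed modules.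
-/

-- `Summit.PneNP.PneNP.…` duplicates `PneNP` BY DESIGN (single-problem summit, D-0017).
set_option linter.dupNamespace false

namespace Summit.PneNP.PneNP.Theorems

open Literature.Computability.Complexity Literature.Computability.MetaComplexity Literature.Barriers.PneNP Filter
open Summit.PneNP.PneNP.Theses.SymmetryBudget (WindowHam)

/-! ### Karp–Lipton: the crux holds unless `PH = Σ₂ᵖ` -/

/-- **`PH ≠ Σ₂ᵖ → WindowHam`** (Karp–Lipton 1980, Thm. 6.1, contrapositive; Arora–Barak 2009, Thm. 6.19), fact-free:
the tree proves Karp–Lipton (`karp_lipton_holds`), so non-collapse of the polynomial hierarchy at level 2 gives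
`NP ⊄ P/poly` (`NPNotSubsetPPoly_of_PH_ne_SigmaP_two`) and hence the crux (`windowHam_of_npNotSubsetPPoly`).
[cite: KarpLipton1980, Thm. 6.1] -/
theorem windowHam_of_PH_ne_SigmaP_two (hPH : PH ≠ SigmaP 2) : WindowHam :=
  windowHam_of_npNotSubsetPPoly (NPNotSubsetPPoly_of_PH_ne_SigmaP_two karp_lipton_holds hPH)

/-- **The known cost of `¬ WindowHam` is exactly a Karp–Lipton collapse**: if HAM has polynomial-size
`Bud(m, ⌊log₂ m⌋)`-symmetric threshold circuits on a tail of sizes, then `NP ⊆ P/poly`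
(`not_windowHam_iff_np_subset_PPoly`) and `PH = Σ₂ᵖ` (Karp–Lipton, proved). [cite: KarpLipton1980, Thm. 6.1] -/
theorem PH_eq_SigmaP_two_of_not_windowHam (h : ¬ WindowHam) : PH = SigmaP 2 :=
  karp_lipton_holds (not_windowHam_iff_np_subset_PPoly.1 h)

/-- **Dichotomy, unconditionally**: the crux holds or the polynomial hierarchy collapses to `Σ₂ᵖ`.
[cite: KarpLipton1980, Thm. 6.1] -/
theorem windowHam_or_PH_eq_SigmaP_two : WindowHam ∨ PH = SigmaP 2 :=
  (Classical.em WindowHam).imp_right PH_eq_SigmaP_two_of_not_windowHam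

/-! ### Cook–Levin form -/

/-- **`WindowHam ↔ SAT ∉ P/poly`**: by `windowHam_iff_npNotSubsetPPoly` and the tree's conjecture-free
identification `npNotSubsetPPoly_iff : NP ⊄ P/poly ↔ SAT ∉ P/poly` (Cook–Levin, `SAT` NP-complete under
reductions `P/poly` is closed under). [cite: AroraBarakCC2009, §6.4 (book p. 113)] -/
theorem windowHam_iff_SAT_not_mem_PPoly : WindowHam ↔ SAT ∉ PPoly :=
  windowHam_iff_npNotSubsetPPoly.trans npNotSubsetPPoly_iff

/-! ### Registered cryptographic hypotheses above the crux -/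

/-- **Krajíček–Pudlák's hypothesis implies the crux**: if the RSA pair of disjoint `NP` sets is not separable in
`P/poly` (`RSAPairInseparable`, a registered conjecture leaf; "stronger than `P/poly ≠ NP`", Krajíček–Pudlák 1998,
Introduction), then `NP ⊄ P/poly` (`RSAPairInseparable.npNotSubsetPPoly`, proved) and hence `WindowHam`.
[cite: KrajicekPudlak1998, Introduction (preprint p. 2) and §1 (p. 3)] -/
theorem windowHam_of_rsaPairInseparable (h : RSAPairInseparable) : WindowHam :=
  windowHam_of_npNotSubsetPPoly h.npNotSubsetPPoly

/-- The same from the bit-security form: security of RSA parity against `P/poly` adversaries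
(`RSAParitySecurePPoly`, registered conjecture leaf) implies `WindowHam`, through
`NPNotSubsetPPoly_of_rsaParitySecurePPoly` (proved). [cite: KrajicekPudlak1998, §1 (preprint p. 3)] -/
theorem windowHam_of_rsaParitySecurePPoly (h : RSAParitySecurePPoly) : WindowHam :=
  windowHam_of_npNotSubsetPPoly (NPNotSubsetPPoly_of_rsaParitySecurePPoly h)

/-! ### The natural proofs barrier applies to the crux verbatim -/

/-- **What a natural proof would give.** A `P/poly`-natural combinatorial property useful against `P/poly`
(`IsNaturalProof Q`, Razborov–Rudich §2) that contains the slices of some `NP` language `L` for infinitely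
many lengths proves `L ∉ P/poly` (`IsNaturalProof.not_mem_PPoly'`, proved), hence `NP ⊄ P/poly`, hence the crux.
This is the shape every "combinatorial" circuit lower bound in print has (Arora–Barak §23.2).
[cite: RazborovRudich1997, §2 (usefulness)] [cite: AroraBarakCC2009, §23.1] -/
theorem windowHam_of_naturalProof {Q : CombinatorialProperty} (hQ : IsNaturalProof Q) {L : Language Bool}
    (hL : L ∈ Nondeterministic.NP) (hQL : ∃ᶠ n in atTop, L.sliceFn n ∈ Q n) : WindowHam :=
  windowHam_iff_not_np_subset_PPoly.2 fun hNP => hQ.not_mem_PPoly' hQL (hNP hL)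

/-- **Natural proofs barrier for the crux** (Razborov–Rudich 1997, Thm. 4.1; Arora–Barak Thm. 23.1, "such
techniques will not be able to prove `NP ⊄ P/poly`"), fact-free except for RR's pseudorandomness hypothesis:
under `HardPRGExist` (2^{k^ε}-hard PRGs in `P/poly`, the SPRNG conjecture) there is NO pair (natural property,
`NP` language met by it infinitely often) — i.e. the route to `WindowHam` of `windowHam_of_naturalProof` is
closed. The barrier is the tree theorem `no_naturalProof_for_of_hardPRG` (GGM + hybrid argument, proved);
it constrains the language form `L ∉ P/poly` — the HAM-matrix form of the crux reduces to it through
`windowHam_iff_not_np_subset_PPoly`. This is the BARRIERS entry `Literature.Barriers.PneNP.NaturalProofs`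
of routes SymmetryBudget / Circuit instantiated at this crux. [cite: RazborovRudich1997, Thm. 4.1] [cite: AroraBarakCC2009, Thm. 23.1] -/
theorem windowHam_naturalProofs_barrier (hG : HardPRGExist) :
    ¬ ∃ (Q : CombinatorialProperty) (L : Language Bool),
        IsNaturalProof Q ∧ L ∈ Nondeterministic.NP ∧ ∃ᶠ n in atTop, L.sliceFn n ∈ Q n :=
  fun ⟨Q, L, hQ, _, hQL⟩ => no_naturalProof_for_of_hardPRG hG L ⟨Q, hQ, hQL⟩

/-! ### The web in one statement -/

/-- **Where stmt-PneNP-2143 sits**, kernel-checked and hypothesis-free: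
`PH ≠ Σ₂ᵖ ∨ RSAPairInseparable ∨ RSAParitySecurePPoly ⟹ WindowHam ⟺ NP ⊄ P/poly ⟺ SAT ∉ P/poly ⟹ PneNP`,
and `¬ WindowHam ⟹ PH = Σ₂ᵖ`. (The by-name equivalences with the route items `Circuit.CircuitThesis` and
`RigidBenchmark` are `windowHam_iff_circuitThesis` / `windowHam_iff_rigidBenchmark` in
`SymmetryBudgetWindowHamCruxLinks.lean`.) [folklore] -/
theorem windowHam_conjecture_web :
    (PH ≠ SigmaP 2 ∨ RSAPairInseparable ∨ RSAParitySecurePPoly → WindowHam) ∧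
    (WindowHam ↔ NPNotSubsetPPoly) ∧ (WindowHam ↔ SAT ∉ PPoly) ∧
    (WindowHam → _root_.PneNP) ∧ (¬ WindowHam → PH = SigmaP 2) :=
  ⟨fun h => h.elim windowHam_of_PH_ne_SigmaP_two
      fun h' => h'.elim windowHam_of_rsaPairInseparable windowHam_of_rsaParitySecurePPoly,
    windowHam_iff_npNotSubsetPPoly, windowHam_iff_SAT_not_mem_PPoly, pneNP_of_windowHam,
    PH_eq_SigmaP_two_of_not_windowHam⟩

end Summit.PneNP.PneNP.Theorems
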